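import Summits.CriticalPhenomena.PercolationContinuityZ3.Theorems.SahiMasterFamilyHSharp
import Summits.CriticalPhenomena.PercolationContinuityZ3.Theorems.SahiMasterFamilyPhiOrbit
import Summits.CriticalPhenomena.PercolationContinuityZ3.Theorems.SahiMasterFamilyPrincipalCapLeSix

/-!
# H♯ from hereditary honesty, every order; the top-free G-system conjecture and the conditional step
# "generalised `C_{≤k}` for G-systems ⟹ H♯ (hence (GH)) for every normalised G-system of order `k+1`"

Unit `prim-masterthm-p4` (gen 20; crux anchor stmt-CriticalPhenomena-4575, helper work; memo
`run/shared/lean/prim/prim-masterthm/prim-masterthm-p4/P4-GEN20-REPORT.md` §4c).  Companion of `…SahiMasterFamilyHSharp` (`HSharp.HSharpNonneg`), `…PhiVertexSharp`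
(the sharp abstract step `phiSet_cap_le`), `…GSystems` / `…GHConjecture` (`GSystemNonneg k` = (GH)_k, normalised G-systems) and `…PrincipalCapStep` (gen 13: the
conditional step `C_{≤k} ⇒ C_{k+1}` on the principal-cap stratum, conclusion `Φ ≥ 0`).

* `hSharp_of_honest` — **every HEREDITARILY HONEST point satisfies H♯, every order**: if `β ≤ 1`, `β univ = 1` and every restriction of `β` along an embedding of a
  smaller index set has `Φ ≥ 0`, then `Φ(cap_t β) ≤ Φ(β)` for every `t`, so `Σ_t Φ(cap_t β) ≤ (k+1)·Φ(β)` (the sharp abstract step after relabelling `t ↔ last`).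
* `GSystemNonnegTF n` — **CONJECTURE (generalised Sahi/Kahn positivity for G-systems, top-free)**: `Φ_n(S ↦ μ_p(G_S)) ≥ 0` for every G-system of increasing events
  (`G_S ∩ G_T ⊆ G_{S∪T}`) on a finite product space, WITHOUT the normalisation `G_univ = Ω`.  For `G_S = ⋂_{j∈S} U_j` this is Sahi's `E_n(1_{U_1},…,1_{U_n}) ≥ 0` for
  increasing events under product measures (Kahn's Conjecture 5 at `n = 3`), so it is OPEN from `n = 3`; `n ≤ 2` is Harris (`gSystemNonnegTF_of_le_two`).  A conjecture-valued
  definition, never a fact.  `gSystemNonneg_of_gSystemNonnegTF` (drop to the normalised case).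
* `gSystem_hSharp_of_gSystemNonnegTF` — **THE CONDITIONAL STEP WITH THE SHARP CONCLUSION**: if `GSystemNonnegTF (n+1)` holds for every `n < k`, then every
  normalised G-system of order `k+1` satisfies H♯ (`Σ_t Φ(cap_t β) ≤ (k+1)·Φ(β)`), because its restrictions are moment functions of (un-normalised) G-systems of
  lower order, i.e. it is hereditarily honest.  (Gen 20's numerics: G-system restrictions are honest in 61 000 sub-functionals, k ≤ 7; general supermultiplicative hull
  points are not — memo §4c.)
HONEST FRAMING: a kernel reduction and a typed conjecture; `GSystemNonnegTF` (n ≥ 3), H♯/GH♯ for G-systems (k ≥ 4), (GH)_k (k ≥ 8), Sahi's `C_k`, Kahn's Conjecture 5 and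
the master theorem remain OPEN.  Axioms standard. [this work]
-/

noncomputable section

open scoped Classical

namespace Summit.CriticalPhenomena.PercolationContinuityZ3.Theorems

namespace GHSharpStep

open Finset
open Literature.Combinatorics.Sahi2008
open Literature.Probability.Percolation.DecisionTree (ind ind_of_mem ind_of_not_mem ind_nonneg)
open PrincipalCapBeta (phiSet)
open GHConjecture (GSystemNonneg)

variable {k : ℕ}

/-! ### Hereditary honesty gives H♯, every order -/

/-- **H♯ at every hereditarily honest point.**  If `β ≤ 1`, `β univ = 1` and `Φ_{n+1}(S ↦ β(e S)) ≥ 0` for every embedding `e : Fin (n+1) ↪ Fin (k+1)` with `n < k`, then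
`Σ_t Φ_{k+1}(cap_t β) ≤ (k+1)·Φ_{k+1}(β)` — indeed `Φ(cap_t β) ≤ Φ(β)` for each `t` (`PhiVertexSharp.phiSet_cap_le` after the relabelling `PhiCert.phiSet_actV`). [this work] -/
theorem hSharp_of_honest (β : Finset (Fin (k + 1)) → ℝ) (h1 : ∀ B, β B ≤ 1) (huniv : β univ = 1)
    (hsub : ∀ (n : ℕ) (e : Fin (n + 1) ↪ Fin (k + 1)), n < k → 0 ≤ phiSet (n + 1) (fun S => β (S.map e))) :
    ∑ t : Fin (k + 1), phiSet (k + 1) (fun S => if t ∈ S then 1 else β S) ≤ ((k + 1 : ℕ) : ℝ) * phiSet (k + 1) β := by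
  have hterm : ∀ t : Fin (k + 1), phiSet (k + 1) (fun S => if t ∈ S then 1 else β S) ≤ phiSet (k + 1) β := by
    intro t
    set σ : Equiv.Perm (Fin (k + 1)) := Equiv.swap t (Fin.last k) with hσ
    have hmem : ∀ S : Finset (Fin (k + 1)), t ∈ S.map σ.toEmbedding ↔ Fin.last k ∈ S := by
      intro S
      rw [Finset.mem_map_equiv]
      have : σ.symm t = Fin.last k := by rw [hσ, Equiv.symm_swap, Equiv.swap_apply_left]
      rw [this]
    have e1 : PhiCert.actV σ (fun S => if t ∈ S then 1 else β S) =
        fun S => if Fin.last k ∈ S then 1 else PhiCert.actV σ β S := by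
      funext S
      unfold PhiCert.actV
      simp only [hmem]
    rw [← PhiCert.phiSet_actV σ (fun S => if t ∈ S then 1 else β S), e1, ← PhiCert.phiSet_actV σ β]
    refine PhiVertexSharp.phiSet_cap_le (PhiCert.actV σ β) (fun B => h1 _) (by rw [PhiCert.actV_univ]; exact huniv) ?_
    intro n e he
    have e2 : (fun S : Finset (Fin (n + 1)) => PhiCert.actV σ β (S.map e)) = fun S => β (S.map (e.trans σ.toEmbedding)) := by
      funext S
      unfold PhiCert.actV
      rw [Finset.map_map]
    rw [e2]
    exact hsub n _ (PhiVertex.lt_of_emb_ne_last e he)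
  calc ∑ t : Fin (k + 1), phiSet (k + 1) (fun S => if t ∈ S then 1 else β S)
      ≤ ∑ _t : Fin (k + 1), phiSet (k + 1) β := sum_le_sum fun t _ => hterm t
    _ = ((k + 1 : ℕ) : ℝ) * phiSet (k + 1) β := by rw [sum_const, card_univ, Fintype.card_fin, nsmul_eq_mul]

/-! ### The top-free G-system conjecture -/

/-- **Conjecture (generalised Sahi/Kahn positivity for G-systems, top-free)**: for every G-system of increasing events `G_S` (`S ⊆ Fin n`, `G_S ∩ G_T ⊆ G_{S∪T}`, NO
condition on `G_univ`) on a finite product space, `Φ_n(S ↦ μ_p(G_S)) ≥ 0`.  Contains Sahi's `E_n ≥ 0` for increasing events under product measures (`G_S = ⋂_{j∈S}U_j`).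
A conjecture-valued definition, never a fact. [this work] [status: open n ≥ 3 (n = 3 ⊇ Kahn's Conjecture 5); n ≤ 2 = Harris; restrictions of sampled G-systems honest, k ≤ 7] -/
@[conjecture] def GSystemNonnegTF (n : ℕ) : Prop :=
  ∀ (ι : Type) [Fintype ι] (p : ι → unitInterval) (G : Finset (Fin n) → Set (Set ι)),
    (∀ S, IsUpperSet (G S)) → (∀ S T, G S ∩ G T ⊆ G (S ∪ T)) →
      0 ≤ phiSet n (fun S => ex (bernoulliWeight p) (ind (G S)))

variable {n : ℕ}

/-- The top-free conjecture contains the normalised one: `GSystemNonnegTF n → (GH)_n`. [this work] -/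
theorem gSystemNonneg_of_gSystemNonnegTF (h : GSystemNonnegTF n) : GSystemNonneg n :=
  fun ι _ p G hup hG _ => h ι p G hup hG

/-- `GSystemNonnegTF n` for `n ≤ 2` (n = 2 is Harris: `μ(G_{01}) ≥ μ(G_0 ∩ G_1) ≥ μ(G_0)μ(G_1)`, `GSystems.gsystem_supermul`). [this work] -/
theorem gSystemNonnegTF_of_le_two (hn : n ≤ 2) : GSystemNonnegTF n := by
  intro ι _ p G hup hG
  interval_cases n
  · exact PhiProduct.phiSet_zero_nonneg _
  · rw [PrincipalCapBeta.phiSet_one]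
    exact GSystems.gsystem_nonneg p G _
  · rw [PrincipalCapBeta.phiSet_two]
    have h := GSystems.gsystem_supermul p G hup hG {0} {1}
    have e : ({0} : Finset (Fin 2)) ∪ {1} = univ := by decide
    rw [e] at h
    linarith

/-! ### The conditional step with the sharp conclusion -/

/-- The restriction of a G-system along an embedding of index sets is a G-system (one order down, in general un-normalised). [this work] -/
theorem gsystem_comp_map {m : ℕ} {ι : Type} (G : Finset (Fin (k + 1)) → Set (Set ι)) (hG : ∀ S T, G S ∩ G T ⊆ G (S ∪ T))
    (e : Fin m ↪ Fin (k + 1)) (S T : Finset (Fin m)) : G (S.map e) ∩ G (T.map e) ⊆ G ((S ∪ T).map e) := by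
  rw [Finset.map_union]; exact hG _ _

/-- **Generalised `C_{≤k}` for G-systems ⟹ H♯ for every normalised G-system of order `k+1`.**  If `GSystemNonnegTF (n+1)` holds for all `n < k`, then for every
normalised G-system `G` of increasing events on `Fin (k+1)` (`G_univ = Ω`), with `β_S = μ_p(G_S)`: `Σ_t Φ_{k+1}(cap_t β) ≤ (k+1)·Φ_{k+1}(β)`. [this work] -/
theorem gSystem_hSharp_of_gSystemNonnegTF (h : ∀ n, n < k → GSystemNonnegTF (n + 1))
    {ι : Type} [Fintype ι] (p : ι → unitInterval) (G : Finset (Fin (k + 1)) → Set (Set ι))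
    (hup : ∀ S, IsUpperSet (G S)) (hG : ∀ S T, G S ∩ G T ⊆ G (S ∪ T)) (htop : G univ = Set.univ) :
    ∑ t : Fin (k + 1), phiSet (k + 1) (fun S => if t ∈ S then 1 else ex (bernoulliWeight p) (ind (G S))) ≤
      ((k + 1 : ℕ) : ℝ) * phiSet (k + 1) (fun S => ex (bernoulliWeight p) (ind (G S))) :=
  hSharp_of_honest _ (fun B => GSystems.gsystem_le_one p G B) (GSystems.gsystem_univ p G htop)
    fun n e hn => h n hn ι p (fun S => G (S.map e)) (fun _ => hup _) (gsystem_comp_map G hG e)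

/-- The same step with the weaker conclusion `Φ ≥ 0` ((GH)_{k+1}), for comparison with `PrincipalCapStep`. [this work] -/
theorem gSystemNonneg_succ_of_gSystemNonnegTF (h : ∀ n, n < k → GSystemNonnegTF (n + 1)) : GSystemNonneg (k + 1) := by
  intro ι _ p G hup hG htop
  have hH := gSystem_hSharp_of_gSystemNonnegTF h p G hup hG htop
  have hsum : 0 ≤ ∑ t : Fin (k + 1), phiSet (k + 1) (fun S => if t ∈ S then 1 else ex (bernoulliWeight p) (ind (G S))) :=
    sum_nonneg fun t _ => HSharp.phiSet_capAt_nonneg _ (fun B => GSystems.gsystem_le_one p G B) t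
  have hpos : (0 : ℝ) < ((k + 1 : ℕ) : ℝ) := by positivity
  nlinarith [hH, hsum, hpos]

end GHSharpStep

end Summit.CriticalPhenomena.PercolationContinuityZ3.Theorems
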